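import Literature.NumberTheory.ComplexMultiplication.CMAlgebraLatticeOrderClassNumberFormula
import HarnessLib

/-!
# A WEAK-EQUIVALENCE CLASS of full lattices in `Y = ℚ ⊕ ℚ ⊕ ℚ` WITHOUT a representative `L_2 ∋ 1` inside an
# order: Hertling–Larabi 2026 Thm. 10.3 (b) FAILS AS PRINTED (refutation record for the proof of Thm. 10.1 =
# Dade–Taussky–Zassenhaus 1962 Theorem C «`L^k` is invertible for `k ≥ n − 1`»)

[node N13c] [stratum S1] [book HertlingLarabi2026 > §10 > Thm. 10.3 (b), Thm. 10.1; §7 > Thm. 7.3, Rem. 7.4]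

Topic `Literature/NumberTheory/ComplexMultiplication`, namespace `Literature.NumberTheory.ComplexMultiplication`;
lane `lit-hodgefound` (Track 2 foundations library), Layer A3, seat p19 generation 33, row g33-#3 — the formal
COUNTEREXAMPLE announced in the lane (gen 32, l.47192; gen 33, `CMAlgebraLatticePowersInvertible` module docstring)
to step (b) of the printed proof of [HertlingLarabi2026, Thm. 10.1] (= [DadeTausskyZassenhaus1962, Thm. C]).

THE PRINTED STATEMENT.  [HertlingLarabi2026, §10 Thm. 10.3]: «Let `n, A, R = ℤ` be as in Theorem 10.1» (a separable
`ℚ`-algebra `A` of dimension `n ≥ 2`). «Consider a full lattice `L ⊂ A` and an order `Λ` with `Λ ⊃ 𝒪(L)` and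
`ΛL ∈ G(Λ)`. … (b) The `w`-equivalence class of `L` contains a lattice `L_2` with `1 ∈ L_2 ⊂ Λ`.»  Its printed proof
reduces `Λ_(p) ⊃ (L_1)_(p)` modulo `pΛ_(p)` and argues «`((L_1)_(p) + pΛ_(p))/pΛ_(p)` is not contained in any of the
maximal ideals `𝔪/pΛ_(p)`. So it is also not contained in their union.» — prime avoidance, which is valid for IDEALS
but not for `𝔽_p`-SUBSPACES met by more than `p` maximal ideals.

THE COUNTEREXAMPLE (this file).  `A = Y = ℚ³ = ∏_{i<3} ℚ` (`n = 3`, the tree's CM-algebra vocabulary with `t = Fin 3`,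
`L_i = ℚ`), `Λ = ℤ³ = Λ_max` (the image of `(Algebra.linearMap ℤ ℚ).compLeft (Fin 3)`), and
`L_1 = {x ∈ ℤ³ : x₀ + x₁ + x₂ ≡ 0 mod 2}` (the image of `comap (∑ᵢ projᵢ) (2ℤ)`):
 * `hypotheses_thm_10_3_evenSumLattice`: `L_1` is a full lattice, `𝒪(L_1) ⊆ Λ`, and `ΛL_1 = Λ` (so `ΛL_1 ∈ G(Λ)`);
 * `not_exists_weak_one_mem_le_order_evenSumLattice`: there is NO full lattice `L_2 ∼_w L_1` (tree spelling
   `1 ∈ (L_1:L_2)(L_2:L_1)`) with `1 ∈ L_2 ⊆ Λ'` for ANY order `Λ'` of `ℚ³` — in particular none with `1 ∈ L_2 ⊆ Λ`;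
 * `exists_weakClass_without_one_mem_le_order`: the packaged existential statement;
 * §3 (sharpness of `n − 1` in `ℚ³`): `evenSumLattice_pow_eq` (`L_1^k = ℤ³` is invertible for `k ≥ 2`),
   `evenSumLattice_mul_div_div_ne` (`L_1` itself is NOT invertible — it would be `∼_w 𝒪(L_1) ∋ 1`),
   `exists_mul_div_div_ne_and_forall_pow_mul_div_div_eq`.
Proof of the non-existence: every order lies in `ℤ³` (`ℤ` integrally closed; tree `order_le_pi_integralClosure`); by
Thm. 7.3 ∕ Rem. 7.4 (tree `exists_forall_prime_locEq_units_smul_of_one_mem_div_mul_div`) `L_2 ∼_w L_1` gives a unit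
`u ∈ (ℚ^×)³` and an odd `s ∈ ℤ` with `sL_2 ⊆ uL_1` and `suL_1 ⊆ L_2`; then `1 ∈ L_2` yields `s u⁻¹ = (m₀, m₁, m₂) ∈ L_1`
(`Σ mᵢ` even) and `e_i + e_j ∈ L_1` yields `k_i = s u_i ∈ ℤ`; `m_i k_i = s²` is odd, so all `m_i` are odd and `Σ mᵢ`
is odd — contradiction.  (Residue picture: `(L_1 + 2Λ)/2Λ = {000, 110, 011, 101} ⊂ 𝔽_2³` is the union of its
intersections with the three maximal ideals `{x_i = 0}` of `Λ/2Λ = 𝔽_2³`.)  Theorem 10.1 itself is NOT contradicted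
(`L_1² = ℤ³` is invertible); the tree proves it under verifiable hypotheses in `CMAlgebraLatticePowersInvertible`
(`pow_mul_div_div_eq_of_forall_exists_units_locEq`) and `CMAlgebraLatticePowersInvertibleLargePrimes`
(`pow_mul_div_div_eq_of_forall_prime_lt_finrank_locEq`, `mul_div_div_eq_of_finrank_eq_two`).  The same lattice
inside the ring of integers of a cubic field in which `2` splits completely defeats (b) for `A` a number field.

## References
* [HertlingLarabi2026] C. Hertling, K. Larabi, *Conjugacy classes of regular integer matrices, commutative semigroups
  of w-classes of full lattices, and Grothendieck groups*, arXiv:2602.14973 (2026), §10 Thm. 10.1, Thm. 10.3 and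
  its proof (held: `paper:arxiv-2602.14973`, chunks p0026–p0028); §7 Thm. 7.3, Rem. 7.4 (chunk p0018).
* [HertlingLarabi2026b] C. Hertling, K. Larabi, *Conjugacy classes of regular integer matrices*, arXiv:2602.15748
  (2026), §4 Thm. 4.4 (DTZ62) [Si70] and Example 4.7 (DTZ62) (sharpness of `n − 1` in a Dedekind domain `ℤ[α]`)
  (held: `paper:arxiv-2602.15748`, chunk p0007).
* [DadeTausskyZassenhaus1962] E. C. Dade, O. Taussky, H. Zassenhaus, *On the theory of orders …*, Math. Ann. 148
  (1962) 31–64, Theorem C (wanted: acq-11370); M. Singer, *Invertible powers of ideals over orders in commutative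
  separable algebras*, Proc. Cambridge Philos. Soc. 67 (1970) 237–242 — a different proof for separable `A`
  (wanted: acq-13810).
-/

noncomputable section

open scoped Classical Pointwise nonZeroDivisors NumberField
open Module NumberField Function

namespace Literature.NumberTheory.ComplexMultiplication

open Literature.NumberTheory.Automorphic

section WeakClassWithoutUnitRepresentative

/-! ## §1 The order `ℤ³ ⊂ ℚ³` and the lattice `L_1 = {x ∈ ℤ³ : x₀ + x₁ + x₂ even}` -/

/-- Coordinates of the inclusion `ι : ℤ³ → ℚ³`: `ι(m)ᵢ = mᵢ` (file-local). [folklore] -/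
private theorem castPi_apply (m : Fin 3 → ℤ) (i : Fin 3) :
    ((Algebra.linearMap ℤ ℚ).compLeft (Fin 3)) m i = (m i : ℚ) := by
  simp [LinearMap.compLeft]

/-- Membership in `ℤ³ = ι(ℤ³)` (file-local). [folklore] -/
private theorem mem_range_castPi_iff {x : Fin 3 → ℚ} :
    x ∈ LinearMap.range ((Algebra.linearMap ℤ ℚ).compLeft (Fin 3)) ↔ ∃ m : Fin 3 → ℤ, ∀ i, x i = (m i : ℚ) := by
  rw [LinearMap.mem_range]
  constructor
  · rintro ⟨m, rfl⟩
    exact ⟨m, fun i => castPi_apply m i⟩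
  · rintro ⟨m, hm⟩
    exact ⟨m, funext fun i => by rw [castPi_apply, hm i]⟩

/-- Membership in `L_1 = ι({m ∈ ℤ³ : 2 ∣ m₀ + m₁ + m₂})` (file-local). [folklore] -/
private theorem mem_map_castPi_comap_iff {x : Fin 3 → ℚ} :
    x ∈ Submodule.map ((Algebra.linearMap ℤ ℚ).compLeft (Fin 3))
        ((Submodule.span ℤ {(2 : ℤ)}).comap (∑ i : Fin 3, LinearMap.proj i : (Fin 3 → ℤ) →ₗ[ℤ] ℤ)) ↔
      ∃ m : Fin 3 → ℤ, (∀ i, x i = (m i : ℚ)) ∧ (2 : ℤ) ∣ m 0 + m 1 + m 2 := by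
  have key : ∀ m : Fin 3 → ℤ, m ∈ (Submodule.span ℤ {(2 : ℤ)}).comap
      (∑ i : Fin 3, LinearMap.proj i : (Fin 3 → ℤ) →ₗ[ℤ] ℤ) ↔ (2 : ℤ) ∣ m 0 + m 1 + m 2 := fun m => by
    simp [Fin.sum_univ_three, Ideal.mem_span_singleton]
  rw [Submodule.mem_map]
  constructor
  · rintro ⟨m, hm, rfl⟩
    exact ⟨m, fun i => castPi_apply m i, (key m).1 hm⟩
  · rintro ⟨m, hm, hdvd⟩
    exact ⟨m, (key m).2 hdvd, funext fun i => by rw [castPi_apply, hm i]⟩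

/-- `ι(eᵢ + eⱼ) ∈ L_1` for `i ≠ j` (file-local). [folklore] -/
private theorem castPi_single_add_single_mem {i j : Fin 3} (hij : i ≠ j) :
    ((Algebra.linearMap ℤ ℚ).compLeft (Fin 3)) (Pi.single i 1 + Pi.single j 1) ∈
      Submodule.map ((Algebra.linearMap ℤ ℚ).compLeft (Fin 3))
        ((Submodule.span ℤ {(2 : ℤ)}).comap (∑ i : Fin 3, LinearMap.proj i : (Fin 3 → ℤ) →ₗ[ℤ] ℤ)) := by
  refine mem_map_castPi_comap_iff.2 ⟨Pi.single i 1 + Pi.single j 1, fun k => castPi_apply _ k, ?_⟩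
  have hsum : (Pi.single i 1 + Pi.single j 1 : Fin 3 → ℤ) 0 + (Pi.single i 1 + Pi.single j 1 : Fin 3 → ℤ) 1 +
      (Pi.single i 1 + Pi.single j 1 : Fin 3 → ℤ) 2 = 2 := by
    fin_cases i <;> fin_cases j <;> simp_all
  rw [hsum]

/-- `ι(eᵢ) = ι(eᵢ) · ι(eᵢ + eⱼ)` for `i ≠ j` (file-local). [folklore] -/
private theorem castPi_single_eq_mul {i j : Fin 3} (hij : i ≠ j) :
    ((Algebra.linearMap ℤ ℚ).compLeft (Fin 3)) (Pi.single i 1) =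
      ((Algebra.linearMap ℤ ℚ).compLeft (Fin 3)) (Pi.single i 1) *
        ((Algebra.linearMap ℤ ℚ).compLeft (Fin 3)) (Pi.single i 1 + Pi.single j 1) := by
  funext k
  rw [Pi.mul_apply, castPi_apply, castPi_apply, Pi.add_apply]
  by_cases hki : k = i
  · subst hki
    simp [Pi.single_eq_of_ne hij]
  · simp [Pi.single_eq_of_ne hki]

/-- **`ℤ³ ⊂ ℚ³` is an ORDER: a full lattice containing `1` and closed under multiplication.**
[cite: HertlingLarabi2026, §6 Thm. 6.1 (a) (the maximal order `Λ_max(A)` of a separable algebra), chunk p0015] -/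
theorem isFullLattice_range_castPi_and :
    IsFullLattice (Fin 3 → ℚ) (LinearMap.range ((Algebra.linearMap ℤ ℚ).compLeft (Fin 3))) ∧
      (1 : Fin 3 → ℚ) ∈ LinearMap.range ((Algebra.linearMap ℤ ℚ).compLeft (Fin 3)) ∧
      LinearMap.range ((Algebra.linearMap ℤ ℚ).compLeft (Fin 3)) *
          LinearMap.range ((Algebra.linearMap ℤ ℚ).compLeft (Fin 3)) ≤
        LinearMap.range ((Algebra.linearMap ℤ ℚ).compLeft (Fin 3)) := by
  refine ⟨⟨?_, fun d => ?_⟩, mem_range_castPi_iff.2 ⟨1, fun i => by simp⟩,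
    Submodule.mul_le.2 fun a ha b hb => ?_⟩
  · rw [LinearMap.range_eq_map]
    exact Submodule.FG.map _ Module.Finite.fg_top
  · -- clear the three denominators of `d = (d₀, d₁, d₂)`
    refine ⟨((d 0).den * (d 1).den * (d 2).den : ℕ), by exact_mod_cast
      (mul_ne_zero (mul_ne_zero (d 0).den_nz (d 1).den_nz) (d 2).den_nz), mem_range_castPi_iff.2 ?_⟩
    refine ⟨![(d 0).num * (d 1).den * (d 2).den, (d 0).den * (d 1).num * (d 2).den,
      (d 0).den * (d 1).den * (d 2).num], fun i => ?_⟩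
    have h0 := Rat.mul_den_eq_num (d 0)
    have h1 := Rat.mul_den_eq_num (d 1)
    have h2 := Rat.mul_den_eq_num (d 2)
    fin_cases i
    · simp only [Pi.smul_apply, zsmul_eq_mul, Fin.zero_eta, Matrix.cons_val_zero]
      push_cast
      linear_combination ((d 1).den * (d 2).den : ℚ) * h0
    · simp only [Pi.smul_apply, zsmul_eq_mul, Fin.mk_one, Matrix.cons_val_one, Matrix.cons_val_zero]
      push_cast
      linear_combination ((d 0).den * (d 2).den : ℚ) * h1
    · simp only [Pi.smul_apply, zsmul_eq_mul, Fin.reduceFinMk, Matrix.cons_val]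
      push_cast
      linear_combination ((d 0).den * (d 1).den : ℚ) * h2
  · obtain ⟨m, hm⟩ := mem_range_castPi_iff.1 ha
    obtain ⟨m', hm'⟩ := mem_range_castPi_iff.1 hb
    exact mem_range_castPi_iff.2 ⟨m * m', fun i => by rw [Pi.mul_apply, hm i, hm' i, Pi.mul_apply, Int.cast_mul]⟩

/-- **Every order of `ℚ³` lies in `ℤ³`** (orders consist of integral elements and `ℤ` is integrally closed, so
`ℤ³ = Λ_max(ℚ³)`). [cite: HertlingLarabi2026, §6 Thm. 6.1 (a) («`Λ_max(A)`, which contains all other orders»), chunk p0015] -/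
theorem le_range_castPi_of_isOrder {Λ' : Submodule ℤ (Fin 3 → ℚ)} (hΛ' : IsFullLattice (Fin 3 → ℚ) Λ')
    (hΛ'Λ' : Λ' * Λ' ≤ Λ') : Λ' ≤ LinearMap.range ((Algebra.linearMap ℤ ℚ).compLeft (Fin 3)) := fun x hx => by
  have hint := order_le_pi_integralClosure (L := fun _ : Fin 3 => ℚ) hΛ' hΛ'Λ' hx
  rw [mem_piIntegralSubmodule_iff] at hint
  choose m hm using fun i => IsIntegrallyClosed.isIntegral_iff.1 (hint i)
  exact mem_range_castPi_iff.2 ⟨m, fun i => by rw [← hm i]; simp⟩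

/-- **`L_1 = {x ∈ ℤ³ : x₀ + x₁ + x₂ even}` satisfies the hypotheses of HL Thm. 10.3 with `Λ = ℤ³`:** `L_1` is a
full lattice, `𝒪(L_1) = L_1:L_1 ⊆ Λ`, and `ΛL_1 = Λ` — so `ΛL_1 ∈ G(Λ)` (`𝒪(ΛL_1) = Λ` and `ΛL_1` is
`Λ`-invertible, trivially). [cite: HertlingLarabi2026, §10 Thm. 10.3 (hypotheses «an order `Λ` with `Λ ⊃ 𝒪(L)` and `ΛL ∈ G(Λ)`»), chunk p0027] -/
theorem hypotheses_thm_10_3_evenSumLattice :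
    IsFullLattice (Fin 3 → ℚ) (Submodule.map ((Algebra.linearMap ℤ ℚ).compLeft (Fin 3))
        ((Submodule.span ℤ {(2 : ℤ)}).comap (∑ i : Fin 3, LinearMap.proj i : (Fin 3 → ℤ) →ₗ[ℤ] ℤ))) ∧
      Submodule.map ((Algebra.linearMap ℤ ℚ).compLeft (Fin 3))
          ((Submodule.span ℤ {(2 : ℤ)}).comap (∑ i : Fin 3, LinearMap.proj i : (Fin 3 → ℤ) →ₗ[ℤ] ℤ)) /
        Submodule.map ((Algebra.linearMap ℤ ℚ).compLeft (Fin 3))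
          ((Submodule.span ℤ {(2 : ℤ)}).comap (∑ i : Fin 3, LinearMap.proj i : (Fin 3 → ℤ) →ₗ[ℤ] ℤ)) ≤
        LinearMap.range ((Algebra.linearMap ℤ ℚ).compLeft (Fin 3)) ∧
      LinearMap.range ((Algebra.linearMap ℤ ℚ).compLeft (Fin 3)) *
          Submodule.map ((Algebra.linearMap ℤ ℚ).compLeft (Fin 3))
            ((Submodule.span ℤ {(2 : ℤ)}).comap (∑ i : Fin 3, LinearMap.proj i : (Fin 3 → ℤ) →ₗ[ℤ] ℤ)) =
        LinearMap.range ((Algebra.linearMap ℤ ℚ).compLeft (Fin 3)) := by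
  set Λ : Submodule ℤ (Fin 3 → ℚ) := LinearMap.range ((Algebra.linearMap ℤ ℚ).compLeft (Fin 3)) with hΛ
  set L₁ : Submodule ℤ (Fin 3 → ℚ) := Submodule.map ((Algebra.linearMap ℤ ℚ).compLeft (Fin 3))
    ((Submodule.span ℤ {(2 : ℤ)}).comap (∑ i : Fin 3, LinearMap.proj i : (Fin 3 → ℤ) →ₗ[ℤ] ℤ)) with hL₁
  obtain ⟨hΛf, -, hΛΛ⟩ := isFullLattice_range_castPi_and
  have hL₁Λ : L₁ ≤ Λ := fun x hx => by
    obtain ⟨m, hm, -⟩ := mem_map_castPi_comap_iff.1 hx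
    exact mem_range_castPi_iff.2 ⟨m, hm⟩
  -- `2Λ ⊆ L_1`, so `L_1` is full
  have h2 : ∀ x ∈ Λ, (2 : ℤ) • x ∈ L₁ := fun x hx => by
    obtain ⟨m, hm⟩ := mem_range_castPi_iff.1 hx
    refine mem_map_castPi_comap_iff.2 ⟨fun i => 2 * m i, fun i => ?_, ⟨m 0 + m 1 + m 2, by ring⟩⟩
    rw [zsmul_eq_mul, Pi.mul_apply, Pi.intCast_apply, hm i, Int.cast_mul, Int.cast_ofNat]
  have hL₁f : IsFullLattice (Fin 3 → ℚ) L₁ := by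
    refine ⟨Submodule.FG.map _ (IsNoetherian.noetherian _), fun d => ?_⟩
    obtain ⟨n, hn, hnd⟩ := hΛf.2 d
    exact ⟨2 * n, mul_ne_zero two_ne_zero hn, by rw [mul_smul]; exact h2 _ hnd⟩
  refine ⟨hL₁f, ?_, le_antisymm (Submodule.mul_le.2 fun a ha b hb => hΛΛ (Submodule.mul_mem_mul ha (hL₁Λ hb)))
    fun x hx => ?_⟩
  · -- `𝒪(L_1)` is an order, hence inside `ℤ³ = Λ_max`
    exact le_range_castPi_of_isOrder (isFullLattice_div hL₁f hL₁f) (div_self_mul_div_self_eq L₁).le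
  · -- `Λ ⊆ ΛL_1`: `x = Σ mᵢ ι(eᵢ)` and `ι(eᵢ) = ι(eᵢ)·ι(eᵢ + eⱼ) ∈ ΛL_1`
    have he : ∀ i j : Fin 3, i ≠ j → ((Algebra.linearMap ℤ ℚ).compLeft (Fin 3)) (Pi.single i 1) ∈ Λ * L₁ :=
      fun i j hij => by
        rw [castPi_single_eq_mul hij]
        exact Submodule.mul_mem_mul (LinearMap.mem_range_self _ _) (castPi_single_add_single_mem hij)
    obtain ⟨m, hm⟩ := mem_range_castPi_iff.1 hx
    have hx' : x = m 0 • ((Algebra.linearMap ℤ ℚ).compLeft (Fin 3)) (Pi.single 0 1) +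
        m 1 • ((Algebra.linearMap ℤ ℚ).compLeft (Fin 3)) (Pi.single 1 1) +
        m 2 • ((Algebra.linearMap ℤ ℚ).compLeft (Fin 3)) (Pi.single 2 1) := by
      funext k
      fin_cases k <;> simp [hm]
    rw [hx']
    exact Submodule.add_mem _ (Submodule.add_mem _ (Submodule.smul_mem _ _ (he 0 1 (by decide)))
      (Submodule.smul_mem _ _ (he 1 2 (by decide)))) (Submodule.smul_mem _ _ (he 2 0 (by decide)))

/-! ## §2 No lattice weakly equivalent to `L_1` contains `1` and lies in an order -/

/-- **HL 2026 THM. 10.3 (b) FAILS AS PRINTED — a weak class without a representative `L_2 ∋ 1` inside an order.**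
In `Y = ℚ ⊕ ℚ ⊕ ℚ` (`n = 3`), with `Λ = Λ_max = ℤ³` and `L_1 = {x ∈ ℤ³ : x₀ + x₁ + x₂ ≡ 0 (2)}` (which satisfies
the hypotheses of Thm. 10.3: `hypotheses_thm_10_3_evenSumLattice`), there is NO full lattice `L_2` with
`L_2 ∼_w L_1` (tree spelling `1 ∈ (L_1:L_2)(L_2:L_1)`), `1 ∈ L_2` and `L_2 ⊆ Λ'` for an order `Λ'` (a full lattice
with `Λ'Λ' ⊆ Λ'`; the conjunct `1 ∈ Λ'` is not even needed).  Proof: `Λ' ⊆ ℤ³` (`le_range_castPi_of_isOrder`); by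
Thm. 7.3 ∕ Rem. 7.4 (tree `exists_forall_prime_locEq_units_smul_of_one_mem_div_mul_div`) at `p = 2` there are a
unit `u = (u₀, u₁, u₂)` and an odd `s` with `sL_2 ⊆ uL_1`, `suL_1 ⊆ L_2`; `1 ∈ L_2` gives
`s u⁻¹ = (m₀, m₁, m₂) ∈ L_1` (`Σ mᵢ` even), and `su(eᵢ + eⱼ) ∈ L_2 ⊆ ℤ³` gives `kᵢ = s uᵢ ∈ ℤ`; then
`mᵢkᵢ = s²` is odd, so every `mᵢ` is odd and `m₀ + m₁ + m₂` is odd — a contradiction.  (The printed proof applies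
prime avoidance to the `𝔽_2`-SUBSPACE `(L_1 + 2Λ)/2Λ = {000, 110, 011, 101}`, which IS the union of its
intersections with the three maximal ideals of `Λ/2Λ = 𝔽_2³`.  Thm. 10.1 holds here nonetheless: `L_1² = ℤ³`.)
[cite: HertlingLarabi2026, §10 Thm. 10.3 (b) and its proof («So it is also not contained in their union»), chunks p0027–p0028]
[cite: HertlingLarabi2026, §7 Thm. 7.3, Rem. 7.4 (w-equivalence = local equivalence `(L_2)_(p) = a_p (L_1)_(p)`), chunk p0018] -/
theorem not_exists_weak_one_mem_le_order_evenSumLattice :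
    ¬ ∃ L₂ Λ' : Submodule ℤ (Fin 3 → ℚ), IsFullLattice (Fin 3 → ℚ) L₂ ∧
      (1 : Fin 3 → ℚ) ∈ (Submodule.map ((Algebra.linearMap ℤ ℚ).compLeft (Fin 3))
          ((Submodule.span ℤ {(2 : ℤ)}).comap (∑ i : Fin 3, LinearMap.proj i : (Fin 3 → ℤ) →ₗ[ℤ] ℤ)) / L₂) *
        (L₂ / Submodule.map ((Algebra.linearMap ℤ ℚ).compLeft (Fin 3))
          ((Submodule.span ℤ {(2 : ℤ)}).comap (∑ i : Fin 3, LinearMap.proj i : (Fin 3 → ℤ) →ₗ[ℤ] ℤ))) ∧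
      (1 : Fin 3 → ℚ) ∈ L₂ ∧ IsFullLattice (Fin 3 → ℚ) Λ' ∧ Λ' * Λ' ≤ Λ' ∧ L₂ ≤ Λ' := by
  rintro ⟨L₂, Λ', hL₂, hw, h1, hΛ', hΛ'Λ', hL₂Λ'⟩
  obtain ⟨hL₁f, -, -⟩ := hypotheses_thm_10_3_evenSumLattice
  -- `L_2 ⊆ Λ' ⊆ ℤ³`
  have hL₂Z : L₂ ≤ LinearMap.range ((Algebra.linearMap ℤ ℚ).compLeft (Fin 3)) :=
    hL₂Λ'.trans (le_range_castPi_of_isOrder hΛ' hΛ'Λ')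
  -- local equivalence at `p = 2`: `s L_2 ⊆ u L_1` and `s u L_1 ⊆ L_2` with `s` odd
  obtain ⟨a, -, -, hloc⟩ := exists_forall_prime_locEq_units_smul_of_one_mem_div_mul_div hL₁f hL₂ hw
  obtain ⟨s, hs, hL₂u, huL₂⟩ := hloc 2 Nat.prime_two
  have hvu : ∀ i, (((a 2)⁻¹ : (Fin 3 → ℚ)ˣ) : Fin 3 → ℚ) i * (a 2 : Fin 3 → ℚ) i = 1 := fun i => by
    have h := congrFun (a 2).inv_mul i
    rwa [Pi.mul_apply, Pi.one_apply] at h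
  -- (A) `s·u⁻¹ = ι(m)` with `m₀ + m₁ + m₂` even
  have hA := hL₂u 1 h1
  rw [mem_units_smul_submodule_iff] at hA
  obtain ⟨m, hm, hmeven⟩ := mem_map_castPi_comap_iff.1 hA
  have hm' : ∀ i, (s : ℚ) * (((a 2)⁻¹ : (Fin 3 → ℚ)ˣ) : Fin 3 → ℚ) i = m i := fun i => by
    have h := hm i
    rw [Units.smul_def, smul_eq_mul, zsmul_eq_mul, mul_one, Pi.mul_apply, Pi.intCast_apply, mul_comm] at h
    exact h
  -- (B) `s·u·ι(eᵢ + eⱼ) ∈ L_2 ⊆ ℤ³`, so `kᵢ = s·uᵢ ∈ ℤ`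
  have hB : ∀ i j : Fin 3, i ≠ j → ∃ k : ℤ, (s : ℚ) * (a 2 : Fin 3 → ℚ) i = k := fun i j hij => by
    obtain ⟨k, hk⟩ := mem_range_castPi_iff.1 (hL₂Z (huL₂ _
      (Submodule.smul_mem_pointwise_smul _ (a 2) _ (castPi_single_add_single_mem hij))))
    refine ⟨k i, ?_⟩
    have h := hk i
    rw [Units.smul_def, smul_eq_mul, zsmul_eq_mul, Pi.mul_apply, Pi.mul_apply, Pi.intCast_apply, castPi_apply,
      Pi.add_apply, Pi.single_eq_same, Pi.single_eq_of_ne hij, add_zero, Int.cast_one, mul_one] at h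
    exact h
  -- (C) `mᵢ kᵢ = s²` is odd, so `mᵢ` is odd
  have hsodd : Odd s := Int.not_even_iff_odd.1 fun h => hs (even_iff_two_dvd.1 h)
  have hodd : ∀ i, Odd (m i) := fun i => by
    obtain ⟨j, hij⟩ : ∃ j : Fin 3, i ≠ j := ⟨i + 1, by fin_cases i <;> decide⟩
    obtain ⟨k, hk⟩ := hB i j hij
    have hmk : m i * k = s * s := by
      have h : (m i : ℚ) * k = s * s := by
        rw [← hm' i, ← hk]
        calc (s : ℚ) * (((a 2)⁻¹ : (Fin 3 → ℚ)ˣ) : Fin 3 → ℚ) i * ((s : ℚ) * (a 2 : Fin 3 → ℚ) i)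
            = (s : ℚ) * s * ((((a 2)⁻¹ : (Fin 3 → ℚ)ˣ) : Fin 3 → ℚ) i * (a 2 : Fin 3 → ℚ) i) := by ring
          _ = s * s := by rw [hvu i, mul_one]
      exact_mod_cast h
    have hss : Odd (m i * k) := by rw [hmk]; exact hsodd.mul hsodd
    exact (Int.odd_mul.1 hss).1
  -- (D) the sum of three odd integers is odd, not even
  exact Int.not_even_iff_odd.2 (((hodd 0).add_odd (hodd 1)).add_odd (hodd 2)) (even_iff_two_dvd.2 hmeven)

/-- **THE REFUTATION RECORD, packaged: in the `3`-dimensional separable `ℚ`-algebra `Y = ℚ³` there are an order `Λ`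
(even `Λ = Λ_max = ℤ³`, containing every order) and a full lattice `L` with `𝒪(L) ⊆ Λ` and `ΛL = Λ ∈ G(Λ)` whose
`w`-equivalence class contains NO lattice `L_2` with `1 ∈ L_2` contained in an order** — contradicting
[HertlingLarabi2026, Thm. 10.3 (b)] as printed (its clause «`1 ∈ L_2 ⊂ Λ`» and, a fortiori, any order in place of
`Λ`).  Witnesses: `Λ = ℤ³`, `L = {x ∈ ℤ³ : x₀ + x₁ + x₂ even}`
(`hypotheses_thm_10_3_evenSumLattice`, `not_exists_weak_one_mem_le_order_evenSumLattice`).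
[cite: HertlingLarabi2026, §10 Thm. 10.3 (b) («The w-equivalence class of L contains a lattice L_2 with 1 ∈ L_2 ⊂ Λ»), chunk p0027] -/
theorem exists_weakClass_without_one_mem_le_order :
    ∃ Λ L : Submodule ℤ (Fin 3 → ℚ), IsFullLattice (Fin 3 → ℚ) Λ ∧ (1 : Fin 3 → ℚ) ∈ Λ ∧ Λ * Λ ≤ Λ ∧
      (∀ Λ' : Submodule ℤ (Fin 3 → ℚ), IsFullLattice (Fin 3 → ℚ) Λ' → Λ' * Λ' ≤ Λ' → Λ' ≤ Λ) ∧
      IsFullLattice (Fin 3 → ℚ) L ∧ L / L ≤ Λ ∧ Λ * L = Λ ∧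
      ¬ ∃ L₂ Λ' : Submodule ℤ (Fin 3 → ℚ), IsFullLattice (Fin 3 → ℚ) L₂ ∧ (1 : Fin 3 → ℚ) ∈ (L / L₂) * (L₂ / L) ∧
        (1 : Fin 3 → ℚ) ∈ L₂ ∧ IsFullLattice (Fin 3 → ℚ) Λ' ∧ Λ' * Λ' ≤ Λ' ∧ L₂ ≤ Λ' := by
  obtain ⟨hΛf, h1Λ, hΛΛ⟩ := isFullLattice_range_castPi_and
  obtain ⟨hLf, hOL, hΛL⟩ := hypotheses_thm_10_3_evenSumLattice
  exact ⟨_, _, hΛf, h1Λ, hΛΛ, fun Λ' hΛ' hΛ'Λ' => le_range_castPi_of_isOrder hΛ' hΛ'Λ', hLf, hOL, hΛL,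
    not_exists_weak_one_mem_le_order_evenSumLattice⟩

/-! ## §3 Sharpness of the bound `n − 1 = 2` of Theorem 10.1 in `ℚ³`: `L_1` is NOT invertible, `L_1^k = ℤ³` for `k ≥ 2` -/

/-- `ι(eᵢ) = ι(eᵢ + eⱼ) · ι(eᵢ + e_k)` for pairwise distinct `i, j, k` (file-local). [folklore] -/
private theorem castPi_single_eq_add_mul_add {i j k : Fin 3} (hij : i ≠ j) (hik : i ≠ k) (hjk : j ≠ k) :
    ((Algebra.linearMap ℤ ℚ).compLeft (Fin 3)) (Pi.single i 1) =
      ((Algebra.linearMap ℤ ℚ).compLeft (Fin 3)) (Pi.single i 1 + Pi.single j 1) *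
        ((Algebra.linearMap ℤ ℚ).compLeft (Fin 3)) (Pi.single i 1 + Pi.single k 1) := by
  funext l
  rw [Pi.mul_apply, castPi_apply, castPi_apply, castPi_apply, Pi.add_apply, Pi.add_apply]
  by_cases hli : l = i
  · subst hli
    simp [Pi.single_eq_of_ne hij, Pi.single_eq_of_ne hik]
  · by_cases hlj : l = j
    · subst hlj
      simp [Pi.single_eq_of_ne hli, Pi.single_eq_of_ne hjk]
    · simp [Pi.single_eq_of_ne hli, Pi.single_eq_of_ne hlj]

/-- **`L_1² = ℤ³`, hence `L_1^k = ℤ³` for every `k ≥ 2 = n − 1`** (`eᵢ = (eᵢ + eⱼ)(eᵢ + e_k)`), and `ℤ³` is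
invertible (an order) — the conclusion of Thm. 10.1 for `L_1`, checked directly.
[cite: HertlingLarabi2026, §10 Thm. 10.1 («each power `L^k` with `k ≥ n − 1` is invertible»), chunk p0026] -/
theorem evenSumLattice_pow_eq {k : ℕ} (hk : 2 ≤ k) :
    Submodule.map ((Algebra.linearMap ℤ ℚ).compLeft (Fin 3))
          ((Submodule.span ℤ {(2 : ℤ)}).comap (∑ i : Fin 3, LinearMap.proj i : (Fin 3 → ℤ) →ₗ[ℤ] ℤ)) ^ k =
        LinearMap.range ((Algebra.linearMap ℤ ℚ).compLeft (Fin 3)) ∧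
      LinearMap.range ((Algebra.linearMap ℤ ℚ).compLeft (Fin 3)) *
          ((LinearMap.range ((Algebra.linearMap ℤ ℚ).compLeft (Fin 3)) /
              LinearMap.range ((Algebra.linearMap ℤ ℚ).compLeft (Fin 3))) /
            LinearMap.range ((Algebra.linearMap ℤ ℚ).compLeft (Fin 3))) =
        LinearMap.range ((Algebra.linearMap ℤ ℚ).compLeft (Fin 3)) /
          LinearMap.range ((Algebra.linearMap ℤ ℚ).compLeft (Fin 3)) := by
  set Λ : Submodule ℤ (Fin 3 → ℚ) := LinearMap.range ((Algebra.linearMap ℤ ℚ).compLeft (Fin 3)) with hΛ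
  set L₁ : Submodule ℤ (Fin 3 → ℚ) := Submodule.map ((Algebra.linearMap ℤ ℚ).compLeft (Fin 3))
    ((Submodule.span ℤ {(2 : ℤ)}).comap (∑ i : Fin 3, LinearMap.proj i : (Fin 3 → ℤ) →ₗ[ℤ] ℤ)) with hL₁
  obtain ⟨hΛf, h1Λ, hΛΛ⟩ := isFullLattice_range_castPi_and
  obtain ⟨-, -, hΛL⟩ := hypotheses_thm_10_3_evenSumLattice
  have hL₁Λ : L₁ ≤ Λ := fun x hx => by
    obtain ⟨m, hm, -⟩ := mem_map_castPi_comap_iff.1 hx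
    exact mem_range_castPi_iff.2 ⟨m, hm⟩
  have hΛΛ' : Λ * Λ = Λ := (mul_self_eq_iff_one_mem hΛf).2 ⟨h1Λ, hΛΛ⟩
  -- `L_1² = Λ`
  have hsq : L₁ * L₁ = Λ := by
    refine le_antisymm ((Submodule.mul_le.2 fun a ha b hb => Submodule.mul_mem_mul (hL₁Λ ha) hb).trans hΛL.le)
      fun x hx => ?_
    have he : ∀ i j k : Fin 3, i ≠ j → i ≠ k → j ≠ k →
        ((Algebra.linearMap ℤ ℚ).compLeft (Fin 3)) (Pi.single i 1) ∈ L₁ * L₁ := fun i j k hij hik hjk => by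
      rw [castPi_single_eq_add_mul_add hij hik hjk]
      exact Submodule.mul_mem_mul (castPi_single_add_single_mem hij) (castPi_single_add_single_mem hik)
    obtain ⟨m, hm⟩ := mem_range_castPi_iff.1 hx
    have hx' : x = m 0 • ((Algebra.linearMap ℤ ℚ).compLeft (Fin 3)) (Pi.single 0 1) +
        m 1 • ((Algebra.linearMap ℤ ℚ).compLeft (Fin 3)) (Pi.single 1 1) +
        m 2 • ((Algebra.linearMap ℤ ℚ).compLeft (Fin 3)) (Pi.single 2 1) := by
      funext k
      fin_cases k <;> simp [hm]
    rw [hx']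
    exact Submodule.add_mem _ (Submodule.add_mem _
      (Submodule.smul_mem _ _ (he 0 1 2 (by decide) (by decide) (by decide)))
      (Submodule.smul_mem _ _ (he 1 0 2 (by decide) (by decide) (by decide))))
      (Submodule.smul_mem _ _ (he 2 0 1 (by decide) (by decide) (by decide)))
  refine ⟨?_, mul_div_div_eq_of_exists_mul_eq ⟨Λ, by rw [hΛΛ', div_self_eq_of_one_mem h1Λ hΛΛ]⟩⟩
  -- `L_1^k = Λ` for `k ≥ 2` by induction
  induction k, hk using Nat.le_induction with
  | base => rw [pow_two, hsq]
  | succ k hk ih => rw [pow_succ, ih, hΛL]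

/-- **SHARPNESS: `L_1` itself is NOT invertible** (`L_1·(𝒪(L_1):L_1) ≠ 𝒪(L_1)`): an invertible lattice is weakly
equivalent to its own order `𝒪(L_1) ∋ 1` (tree `one_mem_div_mul_div_order_iff`), which §2 forbids.  So in the
`3`-dimensional algebra `ℚ³` the exponent `n − 1 = 2` of Thm. 10.1 cannot be lowered to `1` — the analogue in
`ℚ ⊕ ℚ ⊕ ℚ` of the Dedekind example `𝔏 = (1, α, 4α²)` of [DTZ62] («the bound is sharp»).
[cite: HertlingLarabi2026, §10 Thm. 10.1, chunk p0026] [cite: HertlingLarabi2026b, §4 Thm. 4.4, Ex. 4.7 (DTZ62) (sharpness in `ℤ[α]`), chunk p0007] -/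
theorem evenSumLattice_mul_div_div_ne :
    Submodule.map ((Algebra.linearMap ℤ ℚ).compLeft (Fin 3))
          ((Submodule.span ℤ {(2 : ℤ)}).comap (∑ i : Fin 3, LinearMap.proj i : (Fin 3 → ℤ) →ₗ[ℤ] ℤ)) *
        ((Submodule.map ((Algebra.linearMap ℤ ℚ).compLeft (Fin 3))
            ((Submodule.span ℤ {(2 : ℤ)}).comap (∑ i : Fin 3, LinearMap.proj i : (Fin 3 → ℤ) →ₗ[ℤ] ℤ)) /
          Submodule.map ((Algebra.linearMap ℤ ℚ).compLeft (Fin 3))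
            ((Submodule.span ℤ {(2 : ℤ)}).comap (∑ i : Fin 3, LinearMap.proj i : (Fin 3 → ℤ) →ₗ[ℤ] ℤ))) /
          Submodule.map ((Algebra.linearMap ℤ ℚ).compLeft (Fin 3))
            ((Submodule.span ℤ {(2 : ℤ)}).comap (∑ i : Fin 3, LinearMap.proj i : (Fin 3 → ℤ) →ₗ[ℤ] ℤ))) ≠
      Submodule.map ((Algebra.linearMap ℤ ℚ).compLeft (Fin 3))
          ((Submodule.span ℤ {(2 : ℤ)}).comap (∑ i : Fin 3, LinearMap.proj i : (Fin 3 → ℤ) →ₗ[ℤ] ℤ)) /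
        Submodule.map ((Algebra.linearMap ℤ ℚ).compLeft (Fin 3))
          ((Submodule.span ℤ {(2 : ℤ)}).comap (∑ i : Fin 3, LinearMap.proj i : (Fin 3 → ℤ) →ₗ[ℤ] ℤ)) := by
  intro hinv
  set L₁ : Submodule ℤ (Fin 3 → ℚ) := Submodule.map ((Algebra.linearMap ℤ ℚ).compLeft (Fin 3))
    ((Submodule.span ℤ {(2 : ℤ)}).comap (∑ i : Fin 3, LinearMap.proj i : (Fin 3 → ℤ) →ₗ[ℤ] ℤ)) with hL₁
  obtain ⟨hL₁f, -, -⟩ := hypotheses_thm_10_3_evenSumLattice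
  have hO := isFullLattice_div hL₁f hL₁f
  exact not_exists_weak_one_mem_le_order_evenSumLattice ⟨L₁ / L₁, L₁ / L₁, hO,
    (one_mem_div_mul_div_order_iff (one_mem_div_self L₁) (div_self_mul_div_self_eq L₁).le).2 ⟨rfl, hinv⟩,
    one_mem_div_self L₁, hO, (div_self_mul_div_self_eq L₁).le, le_rfl⟩

/-- **THE BOUND `n − 1` OF THEOREM 10.1 IS ATTAINED IN `ℚ³`, packaged:** there is a full lattice `L ⊂ ℚ ⊕ ℚ ⊕ ℚ`
(`n = 3`) which is NOT invertible while every power `L^k`, `k ≥ 2 = n − 1`, is invertible (indeed `= ℤ³`).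
Witness `L = L_1 = {x ∈ ℤ³ : x₀ + x₁ + x₂ even}` (`evenSumLattice_mul_div_div_ne`, `evenSumLattice_pow_eq`).
[cite: HertlingLarabi2026, §10 Thm. 10.1, chunk p0026] [cite: HertlingLarabi2026b, §4 Ex. 4.7 (DTZ62), chunk p0007] -/
theorem exists_mul_div_div_ne_and_forall_pow_mul_div_div_eq :
    ∃ L : Submodule ℤ (Fin 3 → ℚ), IsFullLattice (Fin 3 → ℚ) L ∧ L * ((L / L) / L) ≠ L / L ∧
      ∀ k : ℕ, 2 ≤ k → L ^ k * ((L ^ k / L ^ k) / L ^ k) = L ^ k / L ^ k := by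
  obtain ⟨hL₁f, -, -⟩ := hypotheses_thm_10_3_evenSumLattice
  refine ⟨_, hL₁f, evenSumLattice_mul_div_div_ne, fun k hk => ?_⟩
  obtain ⟨hpow, hinv⟩ := evenSumLattice_pow_eq hk
  rw [hpow]
  exact hinv

end WeakClassWithoutUnitRepresentative

end Literature.NumberTheory.ComplexMultiplication
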